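import Literature.IUT.HodgeArakelov.CohomologyLimitKummerGalois
import Literature.IUT.HodgeArakelov.CohomologyLimitRestrictionInjective

/-!
# No invariants of the cyclotome under open subgroups of `G_k`, and the INJECTIVITY of
# `lim_J H¹(J, (l·Δ_Θ)(Π)) → lim_J H¹(Π_Ÿ(Π)|_J, (l·Δ_Θ)(Π))` ([IUTchII] Cor. 1.12 (c) "natural inclusion")

Proof-only companion (abc-iut cell, D-0067 wave 4, seat abc-iut-w4-d007, layer L6) of abc-iut-w4-d041's
`CohomologyLimitRestrictionInjective.lean` (p412891: `h1LimRestrict_injective_of_forall_fixed_eq_one` — the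
restriction of abc-iut-L6-t1's cohomology limits `h1Lim φ A H J → h1Lim φ A D J`, `D ⊴ Π`, `D ≤ H`, is injective
AS SOON AS no element `≠ 1` of the coefficients `A` is fixed by `D ∩ K` for `K` finite-index open — "at the model:
the cyclotome `(l·Δ_Θ)(Π)` has no nontrivial invariants under an open subgroup of `Π_Ÿ(Π)` (finitely many roots
of unity in finite extensions of `k`), an input to be supplied BY NAME by the instantiating seat").
S. Mochizuki, *Inter-universal Teichmüller theory II*, Cor. 1.12 (c) p. 56: "one has a natural inclusion
`M^×_TM(Π) ↪ lim_J H¹(J, (l·Δ_Θ)(Π))`, hence a natural inclusion of `M^×_TM(Π)` into the inductive limit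
[`lim_J H¹(Π_Ÿ(Π)|_J, (l·Δ_Θ)(Π))`]" [cite: Mochizuki2012, Cor 1.12 (c) p.56] — the interface field
`ThetaEvaluation.inclHd_injective` of abc-iut-L6-t1's `ConstantMultipleRigidity.lean`.

HERE that input is PROVED for every coefficient group `A'` identified with the cyclotome `Λ(k̄ˣ) = μ_Ẑ(k̄)` of an
MLF by a bijective equivariant `c : CyclotomeCoefficients φ A' k̄ˣ` (the cyclotomic-rigidity datum
`μ_Ẑ(G_k) ⥲ (l·Δ_Θ)(Π)` of Cor. 1.11 (a)), for ANY group `Γ` acting on `k̄ˣ` through a homomorphism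
`aug : Γ → G_k` (abc-iut-L4's `MLFClosure C`; the setting of `CohomologyLimitKummerGalois.lean`):
* `cyclotome_eq_one_of_forall_smul_eq` — an element of `Λ(k̄ˣ)` (a compatible system `(ζ_n)` of roots of unity)
  fixed by a subgroup `S ≤ Γ` whose image in `G_k` has FINITE INDEX is trivial: all `ζ_n` lie in one finite
  extension `k′/k` (`exists_finiteDimensional_forall_mem_of_fixed_of_aug`), where each `ζ_n` has `m`-th roots
  `ζ_{nm}` for every `m`, so `ζ_n = 1` by `⋂ₘ (k′ˣ)ᵐ = 1` ([AbsTopIII] Rmk. 1.5.4 (i); abc-iut-L4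
  `MLFClosure.eq_one_of_forall_pos_exists_pow_eq`) [cite: MochizukiAbsTopIII2015, Rmk 1.5.4 (i) p.33];
* `coeff_eq_one_of_forall_conj_eq` — transported along `c`: no `a ≠ 1` in `A'` is fixed (under conjugation
  through `φ`) by such an `S`;
* `h1LimRestrict_injective_of_aug` — hence abc-iut-w4-d041's theorem applies: for `D ⊴ Γ` with `aug(D)` of finite
  index in `G_k` (at the model `D = Π_Ÿ(Π)`: open image) and any `D ≤ H`, `J`, the restriction
  `lim_K H¹(H ⊓ K, A') → lim_K H¹(D ⊓ K, A')` is INJECTIVE — Cor. 1.12 (c)'s "natural inclusion" with `H = Π`.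
Claim key of the interface `Mochizuki2012` (D-0012, disputed); the mathematics is classical (roots of unity in
`p`-adic fields).  No Prop fact, no definition; nothing here bears on [IUTchIII] Cor. 3.12; typed ≠ proved.
-/

namespace Literature.IUT.HodgeArakelov

open Literature.AnabelianGeometry.EtaleTheta Literature.AnabelianGeometry.AbsoluteAnabelian
open CohomologySystemOfContH1

noncomputable section

namespace CohomologySystemOfContH1

variable (C : MLFClosure.{0}) {Γ : Type} [Group Γ] [TopologicalSpace Γ] [IsTopologicalGroup Γ]
  [MulDistribMulAction Γ (C.K)ˣ] (aug : Γ →* (C.K ≃ₐ[C.k] C.K))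
  (haug : ∀ (g : Γ) (u : (C.K)ˣ), ((g • u : (C.K)ˣ) : C.K) = aug g (u : C.K))

omit [TopologicalSpace Γ] [IsTopologicalGroup Γ] in
include haug in
/-- **No invariants of the cyclotome**: an element `ζ = (ζ_n)_n ∈ Λ(k̄ˣ) = μ_Ẑ(k̄)` fixed by a subgroup `S ≤ Γ`
whose image in `G_k` has finite index is trivial (all `ζ_n` lie in a finite `k′/k`, which has only finitely
many roots of unity: `ζ_n = (ζ_{nm})^m` for all `m` forces `ζ_n = 1`). [cite: MochizukiAbsTopIII2015, Rmk 1.5.4 (i) p.33] -/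
theorem cyclotome_eq_one_of_forall_smul_eq (S : Subgroup Γ) [(S.map aug).FiniteIndex]
    (ζ : Literature.AnabelianGeometry.EtaleTheta.cyclotome (C.K)ˣ) (hζ : ∀ g : Γ, g ∈ S → g • ζ = ζ) : ζ = 1 := by
  obtain ⟨E, hE, hmem⟩ := exists_finiteDimensional_forall_mem_of_fixed_of_aug C aug S
  haveI : FiniteDimensional C.k E := hE
  have hcomp : ∀ n : ℕ+, (((ζ : ℕ+ → (C.K)ˣ) n : (C.K)ˣ) : C.K) ∈ E := fun n =>
    hmem _ fun g hg => by
      have h := congrArg (fun ξ : Literature.AnabelianGeometry.EtaleTheta.cyclotome (C.K)ˣ => (((ξ : ℕ+ → (C.K)ˣ) n : (C.K)ˣ) : C.K)) (hζ g hg)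
      simpa [Literature.AnabelianGeometry.EtaleTheta.cyclotome.smul_apply, haug] using h
  apply Subtype.ext
  funext n
  have h1 : (((ζ : ℕ+ → (C.K)ˣ) n : (C.K)ˣ) : C.K) = 1 :=
    MLFClosure.eq_one_of_forall_pos_exists_pow_eq C E (hcomp n) (Units.ne_zero _) fun m hm =>
      ⟨(((ζ : ℕ+ → (C.K)ˣ) (n * ⟨m, hm⟩) : (C.K)ˣ) : C.K), hcomp _, by
        have h := congrArg (fun v : (C.K)ˣ => (v : C.K)) (Literature.AnabelianGeometry.EtaleTheta.cyclotome.pow_apply_mul ζ n ⟨m, hm⟩)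
        simpa [Units.val_pow_eq_pow_val] using h⟩
  exact Units.ext h1

section Coefficients

variable {G' : Type} [Group G'] [TopologicalSpace G'] [IsTopologicalGroup G']
  (φ : (TopGroup.of Γ) →* G') (A' : Subgroup G') [A'.Normal] [IsMulCommutative A']
  [TopologicalSpace (C.K)ˣ] (c : CyclotomeCoefficients φ A' (C.K)ˣ)

omit [IsTopologicalGroup G'] [IsMulCommutative A'] in
include haug in
/-- Transported along a BIJECTIVE equivariant change of coefficient cyclotome `c : Λ(k̄ˣ) ⥲ A'` (the cyclotomic
rigidity datum `μ_Ẑ(G_k) ⥲ (l·Δ_Θ)(Π)`): no `a ≠ 1` of `A'` is fixed, under conjugation through `φ`, by a subgroup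
`S ≤ Γ` with finite-index image in `G_k`. [cite: Mochizuki2012, Cor 1.11 p.49] -/
theorem coeff_eq_one_of_forall_conj_eq (hc : Function.Bijective c.hom) (S : Subgroup Γ)
    [(S.map aug).FiniteIndex] (a : A') (ha : ∀ g : Γ, g ∈ S → MulAut.conjNormal (φ g) a = a) : a = 1 := by
  obtain ⟨ζ, rfl⟩ := hc.2 a
  have hζ : ζ = 1 := cyclotome_eq_one_of_forall_smul_eq C aug haug S ζ fun g hg =>
    hc.1 (by rw [c.hom_smul]; exact ha g hg)
  rw [hζ, map_one]

include haug in
/-- **[IUTchII] Cor. 1.12 (c) "natural inclusion", DISCHARGED at every Galois-type model**: for `D ⊴ Γ` with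
`aug(D) ≤ G_k` of finite index (the model: `D = Π_Ÿ(Π)`, open image), `D ≤ H ≤ Γ`, and coefficients `A'`
identified with `μ_Ẑ(k̄)` by a bijective `c`, the restriction of abc-iut-L6-t1's cohomology limits
`lim_K H¹(H ⊓ K, A') → lim_K H¹(D ⊓ K, A')` (`h1LimRestrict`, at any base `J`) is INJECTIVE — abc-iut-w4-d041's
`h1LimRestrict_injective_of_forall_fixed_eq_one` with its input supplied. [cite: Mochizuki2012, Cor 1.12 (c) p.56] -/
theorem h1LimRestrict_injective_of_aug (hc : Function.Bijective c.hom) {H D : Subgroup (TopGroup.of Γ)}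
    (hDH : D ≤ H) [D.Normal] [(Subgroup.map aug D).FiniteIndex] (J : Subgroup (TopGroup.of Γ)) :
    Function.Injective (h1LimRestrict φ A' hDH J) :=
  h1LimRestrict_injective_of_forall_fixed_eq_one φ A' hDH J fun K hK _ _ a ha =>
    haveI : K.FiniteIndex := hK
    haveI := finiteIndex_map_inf aug D K
    coeff_eq_one_of_forall_conj_eq C aug haug φ A' c hc (D ⊓ K) a fun g hg => ha g hg

include haug in
/-- The case `H = Γ` and `J = ⊥` — literally the map "`lim_J H¹(J, (l·Δ_Θ)(Π)) → lim_J H¹(Π_Ÿ(Π)|_J, (l·Δ_Θ)(Π))`"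
of Cor. 1.12 (c) (the interface field `ThetaEvaluation.inclHd_injective` of `ConstantMultipleRigidity.lean`, at
the model). [cite: Mochizuki2012, Cor 1.12 (c) p.56] -/
theorem h1LimRestrict_top_bot_injective_of_aug (hc : Function.Bijective c.hom) (D : Subgroup (TopGroup.of Γ))
    [D.Normal] [(Subgroup.map aug D).FiniteIndex] :
    Function.Injective (h1LimRestrict φ A' (le_top : D ≤ ⊤) ⊥) :=
  h1LimRestrict_injective_of_aug C aug haug φ A' c hc le_top ⊥

end Coefficients

end CohomologySystemOfContH1

end

end Literature.IUT.HodgeArakelov
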